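import Mathlib.AlgebraicGeometry.Modules.Sheaf
import Mathlib.Algebra.Category.ModuleCat.Sheaf
import Mathlib.Topology.Sheaves.SheafCondition.UniqueGluing
import HarnessLib

/-!
# The Čech sheaves `Čⁿ(𝓤, M)` of an `𝒪_X`-module (objects, sections, maps into them)

For a scheme `X`, a family of opens `𝓤 = (U_i)_{i ∈ ι}` and an `𝒪_X`-module `M` (Mathlib's
`X.Modules`), the **`n`-th Čech sheaf** `Čⁿ(𝓤, M)` (`Cech.obj U n M`) is the `𝒪_X`-module

  `V ↦ ∏_{α : Fin (n+1) → ι} Γ(M, V ⊓ U_α)`,  `U_α = U_{α 0} ⊓ ⋯ ⊓ U_{α n}` (`face U α`),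

i.e. `∏_α (j_α)_* (M|_{U_α})` (Godement II.5.2; Hartshorne III.4, "sheafified" Čech complex
`𝒞•(𝔘, ℱ)`, Lemma 4.2). This file constructs the object (module structure by restriction of
scalars, sheaf condition componentwise from that of `M`), the calculus of its sections, the
constructor `Cech.homMk` for morphisms INTO `Čⁿ(𝓤, M)` from sectionwise data with the extensionality
principle `Cech.hom_ext_to`, functoriality in `M` (`Cech.map`) and the cosimplicial structure maps
`Cech.structMap g : Čᵐ → Čⁿ` for `g : Fin (m+1) → Fin (n+1)` (restriction from `U_{α ∘ g}` to
`U_α`). The complex, its augmentation and its exactness are in `CechResolution.lean`.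

## References

* R. Godement, *Topologie algébrique et théorie des faisceaux* (1958), II.5.2.
* R. Hartshorne, *Algebraic Geometry*, GTM 52 (1977), III.4, Lemma 4.2. [Hartshorne1977]
-/

noncomputable section

universe u

open CategoryTheory AlgebraicGeometry Opposite TopologicalSpace Limits

namespace Literature.AlgebraicGeometry.Modules

variable {X : Scheme.{u}} {ι : Type u} (U : ι → X.Opens)

/-! ### Faces -/

/-- The open `U_α = ⋂_k U_{α k}` of a simplex `α : Fin (n+1) → ι`. [folklore] -/
def face {n : ℕ} (α : Fin (n + 1) → ι) : X.Opens := ⨅ k, U (α k)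

/-- `U_α ≤ U_{α k}`. [folklore] -/
lemma face_le {n : ℕ} (α : Fin (n + 1) → ι) (k : Fin (n + 1)) : face U α ≤ U (α k) :=
  iInf_le _ k

/-- `U_α ≤ U_{α ∘ g}` for any map of vertices `g`. [folklore] -/
lemma face_le_face_comp {m n : ℕ} (α : Fin (n + 1) → ι) (g : Fin (m + 1) → Fin (n + 1)) :
    face U α ≤ face U (α ∘ g) :=
  le_iInf fun j => iInf_le _ (g j)

/-- A `0`-simplex face is the open itself: `U_{(i)} = U_i` (as an inequality both ways).
[folklore] -/
lemma le_face_zero (α : Fin 1 → ι) : U (α 0) ≤ face U α :=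
  le_iInf fun k => by rw [Fin.eq_zero k]

namespace Cech

variable (n : ℕ) (M : X.Modules)

/-! ### Restriction of sections (notation-free helpers) -/

/-- Restriction of sections of `M` along an inequality of opens. [folklore] -/
abbrev res {V W : X.Opens} (h : W ≤ V) : Γ(M, V) →+ Γ(M, W) :=
  (M.presheaf.map (homOfLE h).op).hom

/-- Restriction of sections of `𝒪_X` along an inequality of opens. [folklore] -/
abbrev resO {V W : X.Opens} (h : W ≤ V) : Γ(X, V) →+* Γ(X, W) :=
  (X.presheaf.map (homOfLE h).op).hom

variable {M} in
/-- Restricting along equal opens twice is the identity-free form of `res (le_refl)`.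
[folklore] -/
@[simp]
lemma res_self {V : X.Opens} (h : V ≤ V) (s : Γ(M, V)) : res M h s = s := by
  have : homOfLE h = 𝟙 V := Subsingleton.elim _ _
  change (M.presheaf.map (homOfLE h).op) s = s
  rw [this, op_id, M.presheaf.map_id]
  rfl

variable {M} in
/-- Morphisms of `𝒪_X`-modules commute with restriction. [folklore] -/
lemma app_res {N : X.Modules} (φ : M ⟶ N) {V W : X.Opens} (h : W ≤ V) (x : Γ(M, V)) :
    φ.app W (res M h x) = res N h (φ.app V x) :=
  ConcreteCategory.congr_hom (φ.mapPresheaf.naturality (homOfLE h).op) x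

variable {M} in
/-- Transitivity of restriction. [folklore] -/
lemma res_res {V W Y : X.Opens} (h : W ≤ V) (h' : Y ≤ W) (s : Γ(M, V)) :
    res M h' (res M h s) = res M (h'.trans h) s := by
  change (M.presheaf.map (homOfLE h).op ≫ M.presheaf.map (homOfLE h').op) s = _
  rw [← Functor.map_comp, ← op_comp]
  rfl

variable {M} in
/-- Restriction is semilinear. [folklore] -/
lemma res_smul {V W : X.Opens} (h : W ≤ V) (r : Γ(X, V)) (s : Γ(M, V)) :
    res M h (r • s) = resO h r • res M h s :=
  M.map_smul (homOfLE h) r s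

/-- Transitivity of restriction for `𝒪_X`. [folklore] -/
lemma resO_resO {V W Y : X.Opens} (h : W ≤ V) (h' : Y ≤ W) (r : Γ(X, V)) :
    resO (X := X) h' (resO h r) = resO (h'.trans h) r := by
  change (X.presheaf.map (homOfLE h).op ≫ X.presheaf.map (homOfLE h').op) r = _
  rw [← Functor.map_comp, ← op_comp]
  rfl

/-! ### The sections `∏_α Γ(M, V ⊓ U_α)` and their module structure -/

/-- The type of `n`-cochains of `M` over `V`: families `(s_α ∈ Γ(M, V ⊓ U_α))_α`. [folklore] -/
def Sections (V : X.Opens) : Type u := ∀ α : Fin (n + 1) → ι, Γ(M, V ⊓ face U α)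

/-- Cochains over `V` form an abelian group (componentwise). [folklore] -/
instance (V : X.Opens) : AddCommGroup (Sections U n M V) :=
  inferInstanceAs (AddCommGroup (∀ α : Fin (n + 1) → ι, Γ(M, V ⊓ face U α)))

/-- The `Γ(X, V)`-module structure on `Γ(M, V ⊓ U_α)` by restriction of scalars. [folklore] -/
@[reducible]
def pieceModule (V : X.Opens) (α : Fin (n + 1) → ι) : Module Γ(X, V) Γ(M, V ⊓ face U α) :=
  Module.compHom _ (resO (X := X) (inf_le_left : V ⊓ face U α ≤ V))

/-- The `Γ(X, V)`-module structure on `n`-cochains over `V` (componentwise). [folklore] -/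
instance sectionsModule (V : X.Opens) : Module Γ(X, V) (Sections U n M V) :=
  @Pi.module (Fin (n + 1) → ι) (fun α => Γ(M, V ⊓ face U α)) Γ(X, V) _ _
    (fun α => pieceModule U n M V α)

variable {U n M}

/-- Components of a sum. [folklore] -/
@[simp] lemma add_apply {V : X.Opens} (s t : Sections U n M V) (α : Fin (n + 1) → ι) :
    (s + t) α = s α + t α := rfl

/-- Components of zero. [folklore] -/
@[simp] lemma zero_apply {V : X.Opens} (α : Fin (n + 1) → ι) : (0 : Sections U n M V) α = 0 := rfl

/-- Components of a negation. [folklore] -/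
@[simp] lemma neg_apply {V : X.Opens} (s : Sections U n M V) (α : Fin (n + 1) → ι) :
    (-s) α = -s α := rfl

/-- Components of a difference. [folklore] -/
@[simp] lemma sub_apply {V : X.Opens} (s t : Sections U n M V) (α : Fin (n + 1) → ι) :
    (s - t) α = s α - t α := rfl

/-- Components of a scalar multiple: `(r • s)_α = r|_{V ⊓ U_α} • s_α`. [folklore] -/
@[simp] lemma smul_apply {V : X.Opens} (r : Γ(X, V)) (s : Sections U n M V)
    (α : Fin (n + 1) → ι) :
    (r • s) α = resO (X := X) (inf_le_left : V ⊓ face U α ≤ V) r • s α := rfl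

/-- Components of an integer multiple. [folklore] -/
@[simp] lemma zsmul_apply {V : X.Opens} (k : ℤ) (s : Sections U n M V) (α : Fin (n + 1) → ι) :
    (k • s) α = k • s α := rfl

/-- Components of a finite sum of cochains. [folklore] -/
@[simp] lemma finset_sum_apply {V : X.Opens} {κ : Type*} (t : Finset κ) (s : κ → Sections U n M V)
    (α : Fin (n + 1) → ι) : (∑ k ∈ t, s k) α = ∑ k ∈ t, s k α :=
  Finset.sum_apply α t s

variable (U n M)

/-- Restriction of cochains to a smaller open (componentwise). [folklore] -/
def restrict {V W : X.Opens} (h : W ≤ V) : Sections U n M V →+ Sections U n M W where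
  toFun s α := res M (inf_le_inf_right (face U α) h) (s α)
  map_zero' := funext fun _ => map_zero _
  map_add' _ _ := funext fun _ => map_add _ _ _

/-- Components of a restricted cochain. [folklore] -/
@[simp] lemma restrict_apply {V W : X.Opens} (h : W ≤ V) (s : Sections U n M V)
    (α : Fin (n + 1) → ι) : restrict U n M h s α = res M (inf_le_inf_right (face U α) h) (s α) := rfl

/-- The presheaf of abelian groups `V ↦ ∏_α Γ(M, V ⊓ U_α)`. [folklore] -/
def presheafAb : TopCat.Presheaf Ab X where
  obj V := AddCommGrpCat.of (Sections U n M V.unop)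
  map i := AddCommGrpCat.ofHom (restrict U n M i.unop.le)
  map_id V := by
    refine AddCommGrpCat.ext fun s => funext fun α => ?_
    exact res_self _ _
  map_comp i j := by
    refine AddCommGrpCat.ext fun s => funext fun α => ?_
    exact (res_res _ _ _).symm

/-- The restriction maps of `presheafAb` are `restrict`. [folklore] -/
@[simp] lemma presheafAb_map_apply {V W : (X.Opens)ᵒᵖ} (i : V ⟶ W) (s : Sections U n M V.unop) :
    (presheafAb U n M).map i s = restrict U n M i.unop.le s := rfl

/-- Restriction of cochains is semilinear. [folklore] -/
lemma restrict_smul {V W : X.Opens} (h : W ≤ V) (r : Γ(X, V)) (s : Sections U n M V) :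
    restrict U n M h (r • s) = resO (X := X) h r • restrict U n M h s := by
  funext α
  rw [restrict_apply, smul_apply, smul_apply, restrict_apply, res_smul, resO_resO, resO_resO]

/-- The presheaf of `𝒪_X`-modules `V ↦ ∏_α Γ(M, V ⊓ U_α)`. [folklore] -/
def presheafMod : X.PresheafOfModules :=
  @PresheafOfModules.ofPresheaf _ _ X.ringCatSheaf.obj (presheafAb U n M)
    (fun V => sectionsModule U n M V.unop) (fun _ _ i r s => restrict_smul U n M i.unop.le r s)

/-! ### The sheaf condition (componentwise) -/

/-- The underlying abelian sheaf of `M` as an object of `Sheaf Ab X`. [folklore] -/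
abbrev abSheaf : TopCat.Sheaf Ab X := (SheafOfModules.toSheaf X.ringCatSheaf).obj M

/-- **`V ↦ ∏_α Γ(M, V ⊓ U_α)` is a sheaf**: compatible families glue componentwise in `M` (on the
cover `V_i ⊓ U_α` of `(⨆ V_i) ⊓ U_α`). [folklore] -/
theorem presheafAb_isSheaf : TopCat.Presheaf.IsSheaf (presheafAb U n M) := by
  rw [TopCat.Presheaf.isSheaf_iff_isSheafUniqueGluing]
  intro κ V sf hsf
  have hcov : ∀ α : Fin (n + 1) → ι, (iSup V) ⊓ face U α ≤ ⨆ i, V i ⊓ face U α := fun α => by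
    rw [← iSup_inf_eq]
  have hcompat : ∀ α : Fin (n + 1) → ι, TopCat.Presheaf.IsCompatible M.presheaf
      (fun i => V i ⊓ face U α) (fun i => (sf i) α) := by
    intro α i j
    have h := congrArg (fun s : Sections U n M (V i ⊓ V j) => s α) (hsf i j)
    simp only [presheafAb_map_apply, restrict_apply] at h
    change res M _ ((sf i) α) = res M _ ((sf j) α)
    have e₁ : V i ⊓ face U α ⊓ (V j ⊓ face U α) ≤ V i ⊓ V j ⊓ face U α :=
      le_inf (inf_le_inf inf_le_left inf_le_left) (inf_le_left.trans inf_le_right)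
    rw [← res_res (inf_le_inf_right (face U α) (inf_le_left : V i ⊓ V j ≤ V i)) e₁,
      ← res_res (inf_le_inf_right (face U α) (inf_le_right : V i ⊓ V j ≤ V j)) e₁]
    exact congrArg _ h
  choose t ht htu using fun α => TopCat.Sheaf.existsUnique_gluing' (abSheaf M)
    (fun i => V i ⊓ face U α) ((iSup V) ⊓ face U α)
    (fun i => homOfLE (inf_le_inf_right (face U α) (le_iSup V i))) (hcov α)
    (fun i => (sf i) α) (hcompat α)
  refine ⟨t, fun i => funext fun α => ht α i, ?_⟩
  intro s hs
  exact funext fun α => htu α (s α) fun i => congrArg (fun s : Sections U n M (V i) => s α) (hs i)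

/-- **The `n`-th Čech sheaf `Čⁿ(𝓤, M)`** of the `𝒪_X`-module `M` for the family of opens `𝓤`:
`V ↦ ∏_{α : Fin (n+1) → ι} Γ(M, V ⊓ U_α)`. [cite: Hartshorne1977, III.4 before Lemma 4.2] -/
def obj : X.Modules where
  val := presheafMod U n M
  isSheaf := presheafAb_isSheaf U n M

/-- Sections of `Čⁿ(𝓤, M)` over `V` ARE cochains (definitional). [folklore] -/
lemma obj_sections (V : X.Opens) : Γ(obj U n M, V) = Sections U n M V := rfl

/-- Restriction of sections of `Čⁿ(𝓤, M)` is componentwise restriction. [folklore] -/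
@[simp] lemma obj_map_apply {V W : X.Opens} (i : W ⟶ V) (s : Γ(obj U n M, V))
    (α : Fin (n + 1) → ι) :
    ((obj U n M).presheaf.map i.op s : Sections U n M W) α =
      res M (inf_le_inf_right (face U α) i.le) ((s : Sections U n M V) α) := rfl

/-- Components of a sum of sections of `Čⁿ(𝓤, M)`. [folklore] -/
@[simp] lemma obj_add_apply {V : X.Opens} (s t : Γ(obj U n M, V)) (α : Fin (n + 1) → ι) :
    ((s + t : Γ(obj U n M, V)) : Sections U n M V) α =
      (s : Sections U n M V) α + (t : Sections U n M V) α := rfl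

/-- Components of a scalar multiple of a section of `Čⁿ(𝓤, M)`. [folklore] -/
@[simp] lemma obj_smul_apply {V : X.Opens} (r : Γ(X, V)) (s : Γ(obj U n M, V))
    (α : Fin (n + 1) → ι) :
    ((r • s : Γ(obj U n M, V)) : Sections U n M V) α =
      resO (X := X) (inf_le_left : V ⊓ face U α ≤ V) r • (s : Sections U n M V) α := rfl

/-- Components of the zero section of `Čⁿ(𝓤, M)`. [folklore] -/
@[simp] lemma obj_zero_apply {V : X.Opens} (α : Fin (n + 1) → ι) :
    ((0 : Γ(obj U n M, V)) : Sections U n M V) α = 0 := rfl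

/-! ### Morphisms into `Čⁿ(𝓤, M)` -/

variable {U n M}

/-- **Morphisms into `Čⁿ(𝓤, M)` from sectionwise data**: a family of additive, `𝒪(V)`-semilinear,
natural maps `Γ(A, V) → ∏_α Γ(M, V ⊓ U_α)`. [folklore] -/
def homMk {A : X.Modules} (f : ∀ V : X.Opens, Γ(A, V) → Sections U n M V)
    (hadd : ∀ (V : X.Opens) (s t : Γ(A, V)), f V (s + t) = f V s + f V t)
    (hsmul : ∀ (V : X.Opens) (r : Γ(X, V)) (s : Γ(A, V)), f V (r • s) = r • f V s)
    (hnat : ∀ (V W : X.Opens) (i : W ⟶ V) (s : Γ(A, V)),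
      f W (A.presheaf.map i.op s) = restrict U n M i.le (f V s)) :
    A ⟶ obj U n M where
  val := PresheafOfModules.homMk
    { app := fun V => AddCommGrpCat.ofHom
        { toFun := f V.unop
          map_zero' := by
            have h := hadd V.unop 0 0
            rw [add_zero] at h
            exact left_eq_add.mp h
          map_add' := hadd V.unop }
      naturality := fun {V W} i => by
        ext s
        exact hnat V.unop W.unop i.unop s }
    (fun V r s => hsmul V.unop r s)

/-- Sections of `homMk`. [folklore] -/
@[simp] lemma homMk_app {A : X.Modules} (f : ∀ V : X.Opens, Γ(A, V) → Sections U n M V)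
    (hadd hsmul hnat) (V : X.Opens) (s : Γ(A, V)) :
    ((homMk f hadd hsmul hnat).app V s : Sections U n M V) = f V s := rfl

/-- **Extensionality for morphisms into `Čⁿ(𝓤, M)`**: test on all components of all sections.
[folklore] -/
lemma hom_ext_to {A : X.Modules} {φ ψ : A ⟶ obj U n M}
    (h : ∀ (V : X.Opens) (s : Γ(A, V)) (α : Fin (n + 1) → ι),
      (φ.app V s : Sections U n M V) α = (ψ.app V s : Sections U n M V) α) : φ = ψ := by
  refine Scheme.Modules.hom_ext _ _ fun V => ?_
  ext s
  exact funext fun α => h V s α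

/-- Sections of a sum of morphisms into `Čⁿ`. [folklore] -/
lemma add_app_apply {A : X.Modules} (φ ψ : A ⟶ obj U n M) (V : X.Opens) (s : Γ(A, V))
    (α : Fin (n + 1) → ι) :
    ((φ + ψ).app V s : Sections U n M V) α =
      (φ.app V s : Sections U n M V) α + (ψ.app V s : Sections U n M V) α := rfl

/-- The `α`-component of the value at a section, as an additive map on morphisms into `Čⁿ`
(so that integer combinations and finite sums of morphisms are evaluated componentwise).
[folklore] -/
def evalAt (A : X.Modules) (V : X.Opens) (s : Γ(A, V)) (α : Fin (n + 1) → ι) :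
    (A ⟶ obj U n M) →+ Γ(M, V ⊓ face U α) where
  toFun φ := (φ.app V s : Sections U n M V) α
  map_zero' := by simp [Scheme.Modules.Hom.zero_app]
  map_add' _ _ := rfl

/-- Unfolding `evalAt`. [folklore] -/
@[simp] lemma evalAt_apply {A : X.Modules} (V : X.Opens) (s : Γ(A, V)) (α : Fin (n + 1) → ι)
    (φ : A ⟶ obj U n M) : evalAt A V s α φ = (φ.app V s : Sections U n M V) α := rfl

/-- Sections of an integer multiple of a morphism into `Čⁿ`. [folklore] -/
lemma zsmul_app_apply {A : X.Modules} (k : ℤ) (φ : A ⟶ obj U n M) (V : X.Opens) (s : Γ(A, V))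
    (α : Fin (n + 1) → ι) :
    ((k • φ).app V s : Sections U n M V) α = k • (φ.app V s : Sections U n M V) α := by
  rw [← evalAt_apply V s α, map_zsmul, evalAt_apply]

/-- Sections of a finite sum of morphisms into `Čⁿ`. [folklore] -/
lemma sum_app_apply {A : X.Modules} {κ : Type*} (t : Finset κ) (φ : κ → (A ⟶ obj U n M))
    (V : X.Opens) (s : Γ(A, V)) (α : Fin (n + 1) → ι) :
    ((∑ k ∈ t, φ k).app V s : Sections U n M V) α =
      ∑ k ∈ t, ((φ k).app V s : Sections U n M V) α := by
  rw [← evalAt_apply V s α, map_sum]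
  rfl

variable (U n M)

/-! ### Functoriality in `M` and the cosimplicial structure maps -/

/-- `Čⁿ(𝓤, –)` on morphisms: componentwise. [folklore] -/
def map {N : X.Modules} (φ : M ⟶ N) : obj U n M ⟶ obj U n N :=
  homMk (fun V s α => φ.app (V ⊓ face U α) ((s : Sections U n M V) α))
    (fun _ s t => funext fun α => by rw [obj_add_apply, map_add]; rfl)
    (fun _ r s => funext fun α => by rw [obj_smul_apply, Scheme.Modules.Hom.app_smul]; rfl)
    (fun V W i s => funext fun α => by
      rw [obj_map_apply, app_res]; rfl)

/-- Components of `Čⁿ(φ)`. [folklore] -/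
@[simp] lemma map_app_apply {N : X.Modules} (φ : M ⟶ N) (V : X.Opens) (s : Γ(obj U n M, V))
    (α : Fin (n + 1) → ι) :
    ((map U n M φ).app V s : Sections U n N V) α = φ.app (V ⊓ face U α) ((s : Sections U n M V) α) :=
  rfl

/-- `Čⁿ(𝟙) = 𝟙`. [folklore] -/
@[simp] lemma map_id : map U n M (𝟙 M) = 𝟙 _ :=
  hom_ext_to fun _ _ _ => rfl

/-- `Čⁿ(φ ≫ ψ) = Čⁿ(φ) ≫ Čⁿ(ψ)`. [folklore] -/
lemma map_comp {N P : X.Modules} (φ : M ⟶ N) (ψ : N ⟶ P) :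
    map U n M (φ ≫ ψ) = map U n M φ ≫ map U n N ψ :=
  hom_ext_to fun _ _ _ => rfl

/-- **The cosimplicial structure map** `Čᵐ(𝓤, M) → Čⁿ(𝓤, M)` along `g : Fin (m+1) → Fin (n+1)`:
`(g^* s)_α = s_{α ∘ g}|_{U_α}`. [folklore] -/
def structMap {m : ℕ} (g : Fin (m + 1) → Fin (n + 1)) : obj U m M ⟶ obj U n M :=
  homMk (fun V s α => res M (inf_le_inf_left V (face_le_face_comp U α g))
      ((s : Sections U m M V) (α ∘ g)))
    (fun _ s t => funext fun α => by rw [obj_add_apply, map_add]; rfl)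
    (fun _ r s => funext fun α => by rw [obj_smul_apply, res_smul, resO_resO]; rfl)
    (fun V W i s => funext fun α => by rw [obj_map_apply, res_res, restrict_apply, res_res])

/-- Components of a structure map. [folklore] -/
@[simp] lemma structMap_app_apply {m : ℕ} (g : Fin (m + 1) → Fin (n + 1)) (V : X.Opens)
    (s : Γ(obj U m M, V)) (α : Fin (n + 1) → ι) :
    ((structMap U n M g).app V s : Sections U n M V) α =
      res M (inf_le_inf_left V (face_le_face_comp U α g)) ((s : Sections U m M V) (α ∘ g)) := rfl

/-- Structure maps are functorial: identity. [folklore] -/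
@[simp] lemma structMap_id : structMap U n M (id : Fin (n + 1) → Fin (n + 1)) = 𝟙 _ :=
  hom_ext_to fun _ _ _ => res_self _ _

/-- Structure maps are functorial: composition (`(h ∘ g)^* = h^* ∘ g^*` contravariantly in the
vertex maps, covariantly in simplices). [folklore] -/
lemma structMap_comp {l m : ℕ} (g : Fin (l + 1) → Fin (m + 1)) (h : Fin (m + 1) → Fin (n + 1)) :
    structMap U n M (h ∘ g) = structMap U m M g ≫ structMap U n M h :=
  hom_ext_to fun V s α => by
    rw [Scheme.Modules.Hom.comp_app, CategoryTheory.comp_apply, structMap_app_apply,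
      structMap_app_apply, structMap_app_apply, res_res]
    rfl

/-- Structure maps commute with `Čⁿ(φ)`. [folklore] -/
lemma structMap_map {N : X.Modules} (φ : M ⟶ N) {m : ℕ} (g : Fin (m + 1) → Fin (n + 1)) :
    structMap U n M g ≫ map U n M φ = map U m M φ ≫ structMap U n N g :=
  hom_ext_to fun V s α => by
    rw [Scheme.Modules.Hom.comp_app, CategoryTheory.comp_apply, map_app_apply,
      structMap_app_apply, Scheme.Modules.Hom.comp_app, CategoryTheory.comp_apply,
      structMap_app_apply, map_app_apply, app_res]

end Cech

end Literature.AlgebraicGeometry.Modules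

end
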